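import Summits.CriticalPhenomena.PercolationContinuityZ3.Theorems.PercNearOneGluingNoHeavyLowerTailKnQuestion8CoefficientwiseCoreClassOneSidedRootRuns
import HarnessLib

/-!
# The one-sided root inequality for bundles, II: the steps of the induction (base, thread, free bit)

Support file (`--supports stmt-CriticalPhenomena-4575`, closed), prover `prim-cplus-coupling` (gen 33).  No definitions, no named facts, no sorries;
standard axioms.  Memo `prim-cplus-coupling/A5-COUPLING-gen33.md` §1.  See `…CoreClassOneSidedRootRuns` for the setting.

The generalized sum.  Edge set `E`, root `c`, observer `a`; `R ⊆ E` (absorbed threads, forced red); `Run ⊆ E ∖ R` (the tied leading run at `c`, all of one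
colour).  For monotone `H ≥ Hᵇ`, `K ≥ Kᵇ`:
  `S(E, R, Run) = Σ_{ω ⊆ E : R ⊆ ω, Run ⊆ ω ∨ Run ∩ ω = ∅, a ∈ C_c ω, a ∉ C_c(E∖ω)} (H(C_c ω) − Hᵇ(C_c(E∖ω)))(K(C_c ω) − Kᵇ(C_c(E∖ω)))`.
* `Coefficientwise.osr_step_base` — if every edge of `E` at `c` lies in `R`, every term is `≥ 0` (`C_c(E∖ω) = {c}`).
* `Coefficientwise.osr_step_thread` — if the run reaches `a` (`a ∈ C_c(Run)`): `S(E, R, Run) = S(E, R ∪ Run, ∅)` (a blue run puts `a` in `C_c(E∖ω)`).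
* `Coefficientwise.osr_step_freeBit` — if the run is closed off (its edges live on `W ∪ {c}`, `W` joined to `c` by the run and met by no other edge):
  `S(E, R, Run) ≥ 2·S(E∖Run, R, ∅)` for the averaged levels `H̄ = (H(·∪W) + H)/2`, `H̄ᵇ = (Hᵇ + Hᵇ(·∪W))/2` (one-bit Chebyshev over the run colour).
[cite: KozmaNitzan2024, Questions 8–9 (§5.5 p. 36) (context: the Question-8 pocket covariance programme)]
-/

namespace Summit.CriticalPhenomena.PercolationContinuityZ3.Theorems

open Finset Literature.Probability.Percolation

namespace Coefficientwise

variable {ι V : Type*}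

open Classical in
/-- Set bookkeeping for tied runs: for `T ⊆ D ⊆ E` and `ω ⊆ E ∖ D`, `E ∖ (ω ∪ T) = ((E ∖ D) ∖ ω) ∪ (D ∖ T)`.
[cite: KozmaNitzan2024, §5.5 (context only; bookkeeping)] -/
theorem sdiff_union_tied (E D T ω : Finset ι) (hD : D ⊆ E) (hω : ω ⊆ E \ D) (hT : T ⊆ D) :
    E \ (ω ∪ T) = ((E \ D) \ ω) ∪ (D \ T) := by
  ext i
  simp only [Finset.mem_sdiff, Finset.mem_union]
  constructor
  · rintro ⟨hiE, hn⟩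
    by_cases hiD : i ∈ D
    · exact Or.inr ⟨hiD, fun h => hn (Or.inr h)⟩
    · exact Or.inl ⟨⟨hiE, hiD⟩, fun h => hn (Or.inl h)⟩
  · rintro (⟨⟨hiE, hiD⟩, hiω⟩ | ⟨hiD, hiT⟩)
    · exact ⟨hiE, fun h => h.elim hiω (fun h' => hiD (hT h'))⟩
    · refine ⟨hD hiD, fun h => h.elim (fun h' => (Finset.mem_sdiff.mp (hω h')).2 hiD) hiT⟩

open Classical in
/-- **BASE STEP.**  If every edge of `E` containing `c` lies in `R`, then every term of `S(E, R, Run)` is nonnegative: for `R ⊆ ω` the blue cluster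
`C_c(E ∖ ω)` is `{c}`, so both factors are `≥ 0` (`Hᵇ{c} ≤ Hᵇ(C_c ω) ≤ H(C_c ω)`). [cite: KozmaNitzan2024, Questions 8–9 (§5.5 p. 36) (context)] -/
theorem osr_step_base (ends : ι → Sym2 V) (E R Run : Finset ι) (c a : V)
    (hc : ∀ i ∈ E, c ∈ ends i → i ∈ R)
    (H Hb K Kb : Set V → ℝ) (hHb : Monotone Hb) (hKb : Monotone Kb) (hHbH : ∀ X, Hb X ≤ H X) (hKbK : ∀ X, Kb X ≤ K X) :
    0 ≤ ∑ ω ∈ E.powerset, (if R ⊆ ω ∧ (Run ⊆ ω ∨ Disjoint Run ω) ∧ a ∈ openCluster (ends '' (↑ω : Set ι)) c ∧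
        a ∉ openCluster (ends '' (↑(E \ ω) : Set ι)) c then
        (H (openCluster (ends '' (↑ω : Set ι)) c) - Hb (openCluster (ends '' (↑(E \ ω) : Set ι)) c)) *
          (K (openCluster (ends '' (↑ω : Set ι)) c) - Kb (openCluster (ends '' (↑(E \ ω) : Set ι)) c)) else 0) := by
  refine Finset.sum_nonneg fun ω _ => ?_
  by_cases hP : R ⊆ ω ∧ (Run ⊆ ω ∨ Disjoint Run ω) ∧ a ∈ openCluster (ends '' (↑ω : Set ι)) c ∧ a ∉ openCluster (ends '' (↑(E \ ω) : Set ι)) c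
  · rw [if_pos hP]
    have hY : openCluster (ends '' (↑(E \ ω) : Set ι)) c = {c} := by
      refine openCluster_eq_singleton_of_no_edge_at ends (E \ ω) fun i hi hci => ?_
      rw [Finset.mem_sdiff] at hi
      exact hi.2 (hP.1 (hc i hi.1 hci))
    rw [hY]
    have hsub : ({c} : Set V) ⊆ openCluster (ends '' (↑ω : Set ι)) c := Set.singleton_subset_iff.mpr (mem_openCluster_self _ _)
    have h1 : 0 ≤ H (openCluster (ends '' (↑ω : Set ι)) c) - Hb {c} := by linarith [hHb hsub, hHbH (openCluster (ends '' (↑ω : Set ι)) c)]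
    have h2 : 0 ≤ K (openCluster (ends '' (↑ω : Set ι)) c) - Kb {c} := by linarith [hKb hsub, hKbK (openCluster (ends '' (↑ω : Set ι)) c)]
    exact mul_nonneg h1 h2
  · rw [if_neg hP]

open Classical in
/-- **THREAD STEP.**  If the tied run joins `c` to `a` (`a ∈ C_c(Run)`, `Run ⊆ E`), then `S(E, R, Run) = S(E, R ∪ Run, ∅)`: a blue run puts `a` into the
blue cluster of `c`, which the event forbids, so only the red run survives. [cite: KozmaNitzan2024, Questions 8–9 (§5.5 p. 36) (context)] -/
theorem osr_step_thread (ends : ι → Sym2 V) (E R Run : Finset ι) (c a : V) (hRunE : Run ⊆ E)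
    (haRun : a ∈ openCluster (ends '' (↑Run : Set ι)) c) (g : Finset ι → ℝ) :
    ∑ ω ∈ E.powerset, (if R ⊆ ω ∧ (Run ⊆ ω ∨ Disjoint Run ω) ∧ a ∈ openCluster (ends '' (↑ω : Set ι)) c ∧
        a ∉ openCluster (ends '' (↑(E \ ω) : Set ι)) c then g ω else 0)
    = ∑ ω ∈ E.powerset, (if R ∪ Run ⊆ ω ∧ (∅ ⊆ ω ∨ Disjoint ∅ ω) ∧ a ∈ openCluster (ends '' (↑ω : Set ι)) c ∧
        a ∉ openCluster (ends '' (↑(E \ ω) : Set ι)) c then g ω else 0) := by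
  refine Finset.sum_congr rfl fun ω hω => ?_
  by_cases hP : R ⊆ ω ∧ (Run ⊆ ω ∨ Disjoint Run ω) ∧ a ∈ openCluster (ends '' (↑ω : Set ι)) c ∧ a ∉ openCluster (ends '' (↑(E \ ω) : Set ι)) c
  · have hRun : Run ⊆ ω := by
      rcases hP.2.1 with h | h
      · exact h
      · exfalso
        have hsub : Run ⊆ E \ ω := fun i hi => Finset.mem_sdiff.mpr ⟨hRunE hi, fun hiω => Finset.disjoint_left.mp h hi hiω⟩
        exact hP.2.2.2 (openCluster_image_mono ends hsub c haRun)
    rw [if_pos hP, if_pos ⟨Finset.union_subset hP.1 hRun, Or.inl (Finset.empty_subset _), hP.2.2⟩]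
  · rw [if_neg hP, if_neg]
    rintro ⟨hRR, -, hev⟩
    exact hP ⟨fun i hi => hRR (Finset.mem_union_left _ hi), Or.inl (fun i hi => hRR (Finset.mem_union_right _ hi)), hev⟩

open Classical in
/-- **FREE-BIT STEP.**  Let `Run ⊆ E ∖ R` be nonempty with all ends in `W ∪ {c}`, every vertex of `W` joined to `c` by `Run`, no other edge of `E` meeting
`W`, and `a ∉ W`.  Then `S(E, R, Run) ≥ 2·S(E ∖ Run, R, ∅)` for the averaged levels `H̄ = (H(· ∪ W) + H)/2`, `H̄ᵇ = (Hᵇ + Hᵇ(· ∪ W))/2` (same for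
`K`): the run colour `ε` is a free bit, `C_c ω = C_c ω° ∪ [ε = red] W`, `C_c(E∖ω) = C_c(E°∖ω°) ∪ [ε = blue] W` (LEMMA A), and one-bit Chebyshev.
[cite: KozmaNitzan2024, Questions 8–9 (§5.5 p. 36) (context)] -/
theorem osr_step_freeBit (ends : ι → Sym2 V) (E R Run : Finset ι) (W : Set V) (c a : V)
    (hRunE : Run ⊆ E) (hRunR : ∀ i ∈ Run, i ∉ R) (hne : Run.Nonempty)
    (hRun : ∀ i ∈ Run, ∀ x, x ∈ ends i → x ∈ W ∨ x = c)
    (hW : ∀ x ∈ W, x ∈ openCluster (ends '' (↑Run : Set ι)) c)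
    (hpriv : ∀ i ∈ E, i ∉ Run → ∀ x, x ∈ ends i → x ∉ W) (haW : a ∉ W)
    (H Hb K Kb : Set V → ℝ) (hH : Monotone H) (hHb : Monotone Hb) (hK : Monotone K) (hKb : Monotone Kb) :
    2 * ∑ ω ∈ (E \ Run).powerset, (if R ⊆ ω ∧ (∅ ⊆ ω ∨ Disjoint ∅ ω) ∧ a ∈ openCluster (ends '' (↑ω : Set ι)) c ∧
        a ∉ openCluster (ends '' (↑((E \ Run) \ ω) : Set ι)) c then
        ((H (openCluster (ends '' (↑ω : Set ι)) c ∪ W) + H (openCluster (ends '' (↑ω : Set ι)) c)) / 2 -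
            (Hb (openCluster (ends '' (↑((E \ Run) \ ω) : Set ι)) c) + Hb (openCluster (ends '' (↑((E \ Run) \ ω) : Set ι)) c ∪ W)) / 2) *
          ((K (openCluster (ends '' (↑ω : Set ι)) c ∪ W) + K (openCluster (ends '' (↑ω : Set ι)) c)) / 2 -
            (Kb (openCluster (ends '' (↑((E \ Run) \ ω) : Set ι)) c) + Kb (openCluster (ends '' (↑((E \ Run) \ ω) : Set ι)) c ∪ W)) / 2) else 0)
    ≤ ∑ ω ∈ E.powerset, (if R ⊆ ω ∧ (Run ⊆ ω ∨ Disjoint Run ω) ∧ a ∈ openCluster (ends '' (↑ω : Set ι)) c ∧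
        a ∉ openCluster (ends '' (↑(E \ ω) : Set ι)) c then
        (H (openCluster (ends '' (↑ω : Set ι)) c) - Hb (openCluster (ends '' (↑(E \ ω) : Set ι)) c)) *
          (K (openCluster (ends '' (↑ω : Set ι)) c) - Kb (openCluster (ends '' (↑(E \ ω) : Set ι)) c)) else 0) := by
  set X : Finset ι → Set V := fun ω => openCluster (ends '' (↑ω : Set ι)) c with hX
  set E' : Finset ι := E \ Run with hE'
  set g : Finset ι → ℝ := fun ω => (H (X ω) - Hb (X (E \ ω))) * (K (X ω) - Kb (X (E \ ω))) with hg
  set Q : Finset ι → Prop := fun ω => R ⊆ ω ∧ a ∈ X ω ∧ a ∉ X (E \ ω) with hQ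
  change 2 * ∑ ω ∈ E'.powerset, (if R ⊆ ω ∧ (∅ ⊆ ω ∨ Disjoint ∅ ω) ∧ a ∈ X ω ∧ a ∉ X (E' \ ω) then
      ((H (X ω ∪ W) + H (X ω)) / 2 - (Hb (X (E' \ ω)) + Hb (X (E' \ ω) ∪ W)) / 2) *
        ((K (X ω ∪ W) + K (X ω)) / 2 - (Kb (X (E' \ ω)) + Kb (X (E' \ ω) ∪ W)) / 2) else 0)
    ≤ ∑ ω ∈ E.powerset, (if R ⊆ ω ∧ (Run ⊆ ω ∨ Disjoint Run ω) ∧ a ∈ X ω ∧ a ∉ X (E \ ω) then g ω else 0)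
  -- split the run-monochromatic sum along `ω ∩ Run ∈ {Run, ∅}`
  have hsplit : ∀ ω ∈ E.powerset, (if R ⊆ ω ∧ (Run ⊆ ω ∨ Disjoint Run ω) ∧ a ∈ X ω ∧ a ∉ X (E \ ω) then g ω else 0)
      = (if ω ∩ Run = Run then (if Q ω then g ω else 0) else 0) + (if ω ∩ Run = ∅ then (if Q ω then g ω else 0) else 0) := by
    intro ω _
    have e1 : Run ⊆ ω ↔ ω ∩ Run = Run := ⟨fun h => Finset.inter_eq_right.mpr h, fun h => Finset.inter_eq_right.mp h⟩
    have e2 : Disjoint Run ω ↔ ω ∩ Run = ∅ := by rw [Finset.disjoint_iff_inter_eq_empty, Finset.inter_comm]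
    have e3 : ¬ (ω ∩ Run = Run ∧ ω ∩ Run = ∅) := by
      rintro ⟨h1, h2⟩; rw [h1] at h2; exact hne.ne_empty h2
    by_cases hQω : Q ω
    · by_cases h1 : ω ∩ Run = Run
      · have h2 : ¬ ω ∩ Run = ∅ := fun h2 => e3 ⟨h1, h2⟩
        rw [if_pos ⟨hQω.1, Or.inl (e1.mpr h1), hQω.2⟩, if_pos h1, if_pos hQω, if_neg h2]; ring
      · by_cases h2 : ω ∩ Run = ∅
        · rw [if_pos ⟨hQω.1, Or.inr (e2.mpr h2), hQω.2⟩, if_neg h1, if_pos h2, if_pos hQω]; ring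
        · rw [if_neg, if_neg h1, if_neg h2]
          · ring
          rintro ⟨_, h | h, _⟩
          · exact h1 (e1.mp h)
          · exact h2 (e2.mp h)
    · rw [if_neg (fun h => hQω ⟨h.1, h.2.2⟩)]
      simp only [if_neg hQω, ite_self, add_zero]
  have hA : (∑ ω ∈ E.powerset, (if ω ∩ Run = Run then (if Q ω then g ω else 0) else 0))
      = ∑ ω ∈ E'.powerset, (if Q (ω ∪ Run) then g (ω ∪ Run) else 0) := by
    rw [show (∑ ω ∈ E.powerset, (if ω ∩ Run = Run then (if Q ω then g ω else 0) else 0))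
        = ∑ ω ∈ E.powerset.filter (fun ω => ω ∩ Run = Run), (if Q ω then g ω else 0) from (Finset.sum_filter _ _).symm]
    exact sum_powerset_inter_eq E Run Run hRunE le_rfl _
  have hB : (∑ ω ∈ E.powerset, (if ω ∩ Run = ∅ then (if Q ω then g ω else 0) else 0))
      = ∑ ω ∈ E'.powerset, (if Q (ω ∪ ∅) then g (ω ∪ ∅) else 0) := by
    rw [show (∑ ω ∈ E.powerset, (if ω ∩ Run = ∅ then (if Q ω then g ω else 0) else 0))
        = ∑ ω ∈ E.powerset.filter (fun ω => ω ∩ Run = ∅), (if Q ω then g ω else 0) from (Finset.sum_filter _ _).symm]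
    exact sum_powerset_inter_eq E Run ∅ hRunE (Finset.empty_subset _) _
  have hS : (∑ ω ∈ E.powerset, (if R ⊆ ω ∧ (Run ⊆ ω ∨ Disjoint Run ω) ∧ a ∈ X ω ∧ a ∉ X (E \ ω) then g ω else 0))
      = (∑ ω ∈ E'.powerset, (if Q (ω ∪ Run) then g (ω ∪ Run) else 0)) + ∑ ω ∈ E'.powerset, (if Q (ω ∪ ∅) then g (ω ∪ ∅) else 0) := by
    rw [Finset.sum_congr rfl hsplit, Finset.sum_add_distrib, hA, hB]
  rw [hS]
  -- cluster bookkeeping on `E' = E \ Run`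
  have hprivω : ∀ ω, ω ⊆ E' → ∀ i ∈ ω, ∀ x, x ∈ ends i → x ∉ W := by
    intro ω hω i hi x hx
    have hi' := Finset.mem_sdiff.mp (hω hi)
    exact hpriv i hi'.1 hi'.2 x hx
  have hXred : ∀ ω, ω ⊆ E' → X (ω ∪ Run) = X ω ∪ W := fun ω hω =>
    openCluster_union_privateBlob ends ω Run W c hRun hW (hprivω ω hω)
  have hYred : ∀ ω, ω ⊆ E' → X (E \ (ω ∪ Run)) = X (E' \ ω) := by
    intro ω hω
    rw [sdiff_union_tied E Run Run ω hRunE hω le_rfl, Finset.sdiff_self, Finset.union_empty]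
  have hYblue : ∀ ω, ω ⊆ E' → X (E \ (ω ∪ ∅)) = X (E' \ ω) ∪ W := by
    intro ω hω
    rw [sdiff_union_tied E Run ∅ ω hRunE hω (Finset.empty_subset _), Finset.sdiff_empty]
    exact openCluster_union_privateBlob ends (E' \ ω) Run W c hRun hW (hprivω (E' \ ω) Finset.sdiff_subset)
  rw [Finset.mul_sum, ← Finset.sum_add_distrib]
  refine Finset.sum_le_sum fun ω hω => ?_
  have hωE' : ω ⊆ E' := Finset.mem_powerset.mp hω
  have hQred : Q (ω ∪ Run) ↔ (R ⊆ ω ∧ a ∈ X ω ∧ a ∉ X (E' \ ω)) := by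
    simp only [hQ]
    rw [hXred ω hωE', hYred ω hωE']
    constructor
    · rintro ⟨hR, ha, hb⟩
      refine ⟨fun i hi => ?_, ha.elim id (fun h => absurd h haW), hb⟩
      rcases Finset.mem_union.mp (hR hi) with h | h
      · exact h
      · exact absurd hi (hRunR i h)
    · rintro ⟨hR, ha, hb⟩
      exact ⟨hR.trans Finset.subset_union_left, Or.inl ha, hb⟩
  have hQblue : Q (ω ∪ ∅) ↔ (R ⊆ ω ∧ a ∈ X ω ∧ a ∉ X (E' \ ω)) := by
    simp only [hQ]
    rw [hYblue ω hωE', Finset.union_empty]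
    constructor
    · rintro ⟨hR, ha, hb⟩; exact ⟨hR, ha, fun h => hb (Or.inl h)⟩
    · rintro ⟨hR, ha, hb⟩; exact ⟨hR, ha, fun h => h.elim hb haW⟩
  by_cases hQ' : R ⊆ ω ∧ a ∈ X ω ∧ a ∉ X (E' \ ω)
  · rw [if_pos ⟨hQ'.1, Or.inl (Finset.empty_subset _), hQ'.2⟩, if_pos (hQred.mpr hQ'), if_pos (hQblue.mpr hQ')]
    simp only [hg]
    rw [hXred ω hωE', hYred ω hωE', hYblue ω hωE', Finset.union_empty]
    -- one-bit Chebyshev with f₁ = red-run term, f₂ = blue-run term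
    have hf : H (X ω) - Hb (X (E' \ ω) ∪ W) ≤ H (X ω ∪ W) - Hb (X (E' \ ω)) := by
      linarith [hH (Set.subset_union_left : X ω ⊆ X ω ∪ W), hHb (Set.subset_union_left : X (E' \ ω) ⊆ X (E' \ ω) ∪ W)]
    have hk : K (X ω) - Kb (X (E' \ ω) ∪ W) ≤ K (X ω ∪ W) - Kb (X (E' \ ω)) := by
      linarith [hK (Set.subset_union_left : X ω ⊆ X ω ∪ W), hKb (Set.subset_union_left : X (E' \ ω) ⊆ X (E' \ ω) ∪ W)]
    have key := oneBit_chebyshev _ _ _ _ hf hk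
    have e1 : (H (X ω ∪ W) - Hb (X (E' \ ω)) + (H (X ω) - Hb (X (E' \ ω) ∪ W))) / 2 =
        (H (X ω ∪ W) + H (X ω)) / 2 - (Hb (X (E' \ ω)) + Hb (X (E' \ ω) ∪ W)) / 2 := by ring
    have e2 : (K (X ω ∪ W) - Kb (X (E' \ ω)) + (K (X ω) - Kb (X (E' \ ω) ∪ W))) / 2 =
        (K (X ω ∪ W) + K (X ω)) / 2 - (Kb (X (E' \ ω)) + Kb (X (E' \ ω) ∪ W)) / 2 := by ring
    rw [e1, e2] at key
    linarith
  · rw [if_neg (fun h => hQ' ⟨h.1, h.2.2⟩), if_neg (fun h => hQ' (hQred.mp h)), if_neg (fun h => hQ' (hQblue.mp h))]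
    linarith

end Coefficientwise

end Summit.CriticalPhenomena.PercolationContinuityZ3.Theorems
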